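import Literature.RepresentationTheory.BorelWallach2000.U11InfinitesimalCharacter
import Literature.NumberTheory.Automorphic.GKModulesSchur
import Mathlib.RingTheory.Finiteness.Finsupp
import HarnessLib

/-!
# `Hom_{(𝔤,K)}(M, M′)` is finite-dimensional for `(𝔤, K)`-modules of finite length of `U(1,1)`, and every `(𝔤, K)`-module of
# finite length of `U(1,1)` is `Z(𝔤)` finite (Knapp–Vogan Cor. 7.207: `ℱ(𝔤, K) ⊆ 𝒞_{Zf}(𝔤, K)`, for `Z(𝔤) = centerU G11`)

Family `hodge`, lane `lit-hodgefound` (foundations library; seat `lit-hodgefound-p39`, generation 22, row g22-#9); topics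
`NumberTheory/Automorphic` (§1, namespace `Literature.NumberTheory.Automorphic.GKHom`, any linear real group `G`) and
`RepresentationTheory/BorelWallach2000` (§2, namespace `…BorelWallach2000.U11HC`, continued).  TWO `def`s with bodies (the
complex-linear maps `GKHom.postComp`, `GKHom.preComp` on `Hom` spaces), theorems otherwise; 0 `sorry`, 0 new axioms, no named fact
(net debt 0, D-0026).

WHY: the general-`G` files of this generation (`GKModulesPrimary`, `…Exact`, `…Support`) are stated for `Z(𝔤)` finite data in
Knapp–Vogan's sense ((7.13) for the full centre `Z(𝔤) = centerU G`), while the `U(1,1)` lineage only knew `(Z, C)`-finiteness; the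
converse bridge needs `Z(𝔤𝔩₂) = ℂ[Z, C̃]`, which the tree does not have.  This file proves `Z(𝔤)` finiteness DIRECTLY for every
`(𝔤, K)`-module of finite length of `U(1,1)`: each `z ∈ Z(𝔤)` acts by a `(𝔤, K)`-endomorphism (`K` connected,
`U11InfinitesimalCharacter`), and `End_{(𝔤,K)}(M)` is finite-dimensional by dévissage along composition series and Schur's lemma.

## Sources

A. W. Knapp, D. A. Vogan, *Cohomological Induction and Unitary Representations* (1995) [KnappVogan1995]: **Cor. 7.207** («for
admissible `V` … (b) `Z(𝔤)` finite ⟺ (c) finite length»; §VII.13 before Cor. 7.208: «`ℱ(𝔤, K)` … is a full subcategory of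
`𝒞_{Zf}(𝔤, K)`»), Thm. 1.117 (d) (`Hom_{𝔤,K} = Hom_R`), Prop. A.12 (Schur); N. R. Wallach, *Real Reductive Groups I*, Lemma 3.3.2
[WallachRRG1].

## What is formalised

* §1 (any `G`, `GKRing G`-modules): `finiteDimensional_of_ker_of_range`, `finiteDimensional_of_forall_eq_zero` (plumbing);
  **`postComp`**, **`preComp`**; **`finiteDimensional_of_target`** (`Hom(M, W′)`, `Hom(M, M′/W′)` f.d. ⟹ `Hom(M, M′)` f.d.),
  **`finiteDimensional_of_source`** (`Hom(M/W, M′)`, `Hom(W, M′)` f.d. ⟹ `Hom(M, M′)` f.d.), `finiteDimensional_of_source_equiv`,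
  `finiteDimensional_of_target_equiv`, `finiteDimensional_of_subsingleton_source/_target`, **`finiteDimensional_of_isIrreducibleGK`**
  (Schur: `Hom(irreducible admissible, irreducible)` is f.d. of dimension `≤ 1`).
* §2 (`U(1,1)`): **`finiteDimensional_hom_of_isIrreducibleGK_target`**, **`finiteDimensional_hom`** (`Hom_{(𝔤,K)}(M, M′)` is
  finite-dimensional for `M`, `M′` of finite length), `finiteDimensional_end`, `exists_restrictScalars_eq_centerAction` (every
  `z ∈ Z(𝔤)` acts by a `(𝔤, K)`-map), **`isCenterFinite_of_isFiniteLength`** (finite length ⟹ `Z(𝔤)` finite), and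
  `isInternal_primaryComponent_of_isFiniteLength` (so Prop. 7.20 applies: `M = ⨁_θ P_θ(M)`, finitely many non-zero).

NOT here: the dimension bound `dim Hom(M, M′) ≤ ℓ(M) ℓ(M′)` (implicit in the proof; not stated); the converse «`Z(𝔤)` finite
admissible ⟹ finite length» in Knapp–Vogan's notion is `U11HC.harishChandra_tfae` composed with `isZCFinite_of_isCenterFinite`
(`UpqCasimirCenter`) and is not restated.

Consumed by name: `GKRing.isFiniteLength_iff_exists_compositionSeries`, `GKRing.Factor`, `isGKModule_factor`, `isIrreducibleGK_factor`,
`GKRing.mkLinearMap`, `GKRing.map_complex_smul`, `GKRing.exists_forall_eq_smul_of_ne_zero` (`GKModuleRing`, `GKJordanHolder`,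
`GKModulesSchur`); `U11Irred.isAdmissibleGK_of_isIrreducibleGK`; `U11Weights.actK_comp_centerAction` (`U11InfinitesimalCharacter`);
`centerAction`, `commute_centerAction_lie`, `IsCenterFinite`, `isInternal_primaryComponent`, `finite_setOf_primaryComponent_ne_bot`
(`GKModulesPrimary`); Mathlib `Submodule.fg_of_fg_map_of_fg_inf_ker`, `Submodule.comapSubtypeEquivOfLe`, `LinearMap.codRestrict`,
`Submodule.liftQ`, `finrank_le_one`, `LinearMap.toSpanSingleton`, `Algebra.adjoin_le`, `Submodule.finiteDimensional_of_le`.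

## References

* A. W. Knapp, D. A. Vogan, *Cohomological Induction and Unitary Representations*, Princeton Math. Ser. 45 (1995), Thm. 1.117 (d),
  §VII.2 (7.13), Prop. 7.20, §VII.13 Cor. 7.207 and before Cor. 7.208, Prop. A.12. [KnappVogan1995]
* N. R. Wallach, *Real Reductive Groups I* (1988), Lemma 3.3.2. [WallachRRG1]
-/


noncomputable section

open scoped Matrix ComplexConjugate
open Polynomial Module Module.End UniversalEnvelopingAlgebra

-- Mathlib idiom (as in `GKModules`, `GKCohomology`): commutator bracket on `Module.End` / matrices
attribute [local instance 100] LieRing.ofAssociativeRing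

/-! ## §1 Any group: dévissage of `Hom` spaces over the operator ring -/

namespace Literature.NumberTheory.Automorphic.GKHom

-- carriers `↥W`, `M ⧸ W` over `GKRing G` with their `ℂ`-structures (as in `GKModuleRing` §7–§8)
set_option maxSynthPendingDepth 4

variable {A : Type*} [NormedCommRing A] [NormedAlgebra ℝ A] [NormedAlgebra ℚ A] [CompleteSpace A]
  [StarRing A] {N : Type*} [Fintype N] [DecidableEq N] {G : RealMatrixGroup A N}
  {M : Type*} [AddCommGroup M] [Module (GKRing G) M] {P : Type*} [AddCommGroup P] [Module (GKRing G) P]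
  {M' : Type*} [AddCommGroup M'] [Module ℂ M'] [Module (GKRing G) M'] [IsScalarTower ℂ (GKRing G) M']
  {M'' : Type*} [AddCommGroup M''] [Module ℂ M''] [Module (GKRing G) M''] [IsScalarTower ℂ (GKRing G) M'']

/-- A complex vector space with a linear map whose kernel and range are finite-dimensional is finite-dimensional (plumbing:
`0 → ker → V → range → 0`). [cite: KnappVogan1995, Cor. 7.207] -/
theorem finiteDimensional_of_ker_of_range {V V' : Type*} [AddCommGroup V] [Module ℂ V] [AddCommGroup V'] [Module ℂ V']
    (f : V →ₗ[ℂ] V') [FiniteDimensional ℂ (LinearMap.ker f)] [FiniteDimensional ℂ (LinearMap.range f)] :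
    FiniteDimensional ℂ V := by
  refine Module.finite_def.mpr (Submodule.fg_of_fg_map_of_fg_inf_ker f ?_ ?_)
  · rw [Submodule.map_top]
    exact Module.Finite.iff_fg.mp inferInstance
  · rw [top_inf_eq]
    exact Module.Finite.iff_fg.mp inferInstance

/-- A vector space all of whose elements vanish is finite-dimensional (plumbing). [cite: KnappVogan1995, Cor. 7.207] -/
theorem finiteDimensional_of_forall_eq_zero {V : Type*} [AddCommGroup V] [Module ℂ V] (h : ∀ v : V, v = 0) :
    FiniteDimensional ℂ V := by
  refine ⟨?_⟩
  rw [show (⊤ : Submodule ℂ V) = ⊥ from (Submodule.eq_bot_iff _).mpr fun v _ => h v]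
  exact Submodule.fg_bot

variable (G) in
/-- Post-composition with the projection `M′ → M′/W′` on `Hom_{(𝔤,K)}(M, M′)` (complex-linear). [cite: KnappVogan1995, Thm. 1.117 (d)] -/
def postComp (W' : Submodule (GKRing G) M') : (M →ₗ[GKRing G] M') →ₗ[ℂ] (M →ₗ[GKRing G] (M' ⧸ W')) where
  toFun φ := W'.mkQ.comp φ
  map_add' φ ψ := by rw [LinearMap.comp_add]
  map_smul' c φ := by
    refine LinearMap.ext fun m => ?_
    rw [RingHom.id_apply, LinearMap.comp_apply, LinearMap.smul_apply, LinearMap.smul_apply, LinearMap.comp_apply,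
      Submodule.mkQ_apply, Submodule.mkQ_apply, Submodule.Quotient.mk_smul]

variable (G) in
/-- Pre-composition with the inclusion `W → M` on `Hom_{(𝔤,K)}(M, M′)` (complex-linear). [cite: KnappVogan1995, Thm. 1.117 (d)] -/
def preComp (W : Submodule (GKRing G) M) : (M →ₗ[GKRing G] M') →ₗ[ℂ] (W →ₗ[GKRing G] M') where
  toFun φ := φ.comp W.subtype
  map_add' φ ψ := by rw [LinearMap.add_comp]
  map_smul' c φ := LinearMap.ext fun w => rfl

/-- **Dévissage in the target: `Hom(M, W′)` and `Hom(M, M′/W′)` finite-dimensional ⟹ `Hom(M, M′)` finite-dimensional**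
(`0 → Hom(M, W′) → Hom(M, M′) → Hom(M, M′/W′)` is exact). [cite: KnappVogan1995, Cor. 7.207] -/
theorem finiteDimensional_of_target (W' : Submodule (GKRing G) M') [FiniteDimensional ℂ (M →ₗ[GKRing G] W')]
    [FiniteDimensional ℂ (M →ₗ[GKRing G] (M' ⧸ W'))] : FiniteDimensional ℂ (M →ₗ[GKRing G] M') := by
  -- the kernel of post-composition embeds into `Hom(M, W′)`
  have hker : ∀ φ : LinearMap.ker (postComp G (M := M) W'), ∀ m : M, (φ : M →ₗ[GKRing G] M') m ∈ W' := by
    intro φ m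
    have h := LinearMap.congr_fun (LinearMap.mem_ker.mp φ.2) m
    rw [LinearMap.zero_apply] at h
    exact (Submodule.Quotient.mk_eq_zero W').mp h
  let ι : LinearMap.ker (postComp G (M := M) W') →ₗ[ℂ] (M →ₗ[GKRing G] W') :=
    { toFun := fun φ => LinearMap.codRestrict W' (φ : M →ₗ[GKRing G] M') (hker φ)
      map_add' := fun φ ψ => LinearMap.ext fun m => Subtype.ext rfl
      map_smul' := fun c φ => LinearMap.ext fun m => Subtype.ext rfl }
  have hι : Function.Injective ι := by
    intro φ ψ h
    refine Subtype.ext (LinearMap.ext fun m => ?_)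
    have h1 := congr_arg (fun f : M →ₗ[GKRing G] W' => (f m : M')) h
    exact h1
  haveI : FiniteDimensional ℂ (LinearMap.ker (postComp G (M := M) W')) := Module.Finite.of_injective ι hι
  haveI : FiniteDimensional ℂ (LinearMap.range (postComp G (M := M) W')) := inferInstance
  exact finiteDimensional_of_ker_of_range (postComp G (M := M) W')

/-- **Dévissage in the source: `Hom(M/W, M′)` and `Hom(W, M′)` finite-dimensional ⟹ `Hom(M, M′)` finite-dimensional**
(`0 → Hom(M/W, M′) → Hom(M, M′) → Hom(W, M′)` is exact). [cite: KnappVogan1995, Cor. 7.207] -/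
theorem finiteDimensional_of_source (W : Submodule (GKRing G) M) [FiniteDimensional ℂ ((M ⧸ W) →ₗ[GKRing G] M')]
    [FiniteDimensional ℂ (W →ₗ[GKRing G] M')] : FiniteDimensional ℂ (M →ₗ[GKRing G] M') := by
  have hker : ∀ φ : LinearMap.ker (preComp G (M' := M') W), W ≤ LinearMap.ker (φ : M →ₗ[GKRing G] M') := by
    intro φ w hw
    have h := LinearMap.congr_fun (LinearMap.mem_ker.mp φ.2) ⟨w, hw⟩
    exact h
  let ι : LinearMap.ker (preComp G (M' := M') W) →ₗ[ℂ] ((M ⧸ W) →ₗ[GKRing G] M') :=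
    { toFun := fun φ => W.liftQ (φ : M →ₗ[GKRing G] M') (hker φ)
      map_add' := fun φ ψ => Submodule.linearMap_qext _ (LinearMap.ext fun m => rfl)
      map_smul' := fun c φ => Submodule.linearMap_qext _ (LinearMap.ext fun m => rfl) }
  have hι : Function.Injective ι := by
    intro φ ψ h
    refine Subtype.ext (LinearMap.ext fun m => ?_)
    have h1 := LinearMap.congr_fun h (Submodule.Quotient.mk m)
    exact h1
  haveI : FiniteDimensional ℂ (LinearMap.ker (preComp G (M' := M') W)) := Module.Finite.of_injective ι hι
  haveI : FiniteDimensional ℂ (LinearMap.range (preComp G (M' := M') W)) := inferInstance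
  exact finiteDimensional_of_ker_of_range (preComp G (M' := M') W)

/-- Transport along an isomorphism of the source. [cite: KnappVogan1995, Thm. 1.117 (d)] -/
theorem finiteDimensional_of_source_equiv (e : M ≃ₗ[GKRing G] P) [FiniteDimensional ℂ (M →ₗ[GKRing G] M')] :
    FiniteDimensional ℂ (P →ₗ[GKRing G] M') := by
  let ι : (P →ₗ[GKRing G] M') →ₗ[ℂ] (M →ₗ[GKRing G] M') :=
    { toFun := fun φ => φ.comp e.toLinearMap
      map_add' := fun φ ψ => by rw [LinearMap.add_comp]
      map_smul' := fun c φ => LinearMap.ext fun m => rfl }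
  refine Module.Finite.of_injective ι fun φ ψ h => LinearMap.ext fun m'' => ?_
  have h1 := LinearMap.congr_fun h (e.symm m'')
  simpa [ι] using h1

/-- Transport along an isomorphism of the target. [cite: KnappVogan1995, Thm. 1.117 (d)] -/
theorem finiteDimensional_of_target_equiv (e : M' ≃ₗ[GKRing G] M'') [FiniteDimensional ℂ (M →ₗ[GKRing G] M')] :
    FiniteDimensional ℂ (M →ₗ[GKRing G] M'') := by
  let ι : (M →ₗ[GKRing G] M'') →ₗ[ℂ] (M →ₗ[GKRing G] M') :=
    { toFun := fun φ => e.symm.toLinearMap.comp φ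
      map_add' := fun φ ψ => by rw [LinearMap.comp_add]
      map_smul' := fun c φ => LinearMap.ext fun m => by
        rw [RingHom.id_apply, LinearMap.comp_apply, LinearMap.smul_apply, LinearMap.smul_apply, LinearMap.comp_apply]
        exact GKRing.map_complex_smul G e.symm.toLinearMap c (φ m) }
  refine Module.Finite.of_injective ι fun φ ψ h => LinearMap.ext fun m => ?_
  have h1 := LinearMap.congr_fun h m
  simpa [ι] using h1

/-- `Hom` out of or into a zero module is finite-dimensional. [cite: KnappVogan1995, Thm. 1.117 (d)] -/
theorem finiteDimensional_of_subsingleton_source [Subsingleton M] : FiniteDimensional ℂ (M →ₗ[GKRing G] M') :=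
  finiteDimensional_of_forall_eq_zero fun φ => LinearMap.ext fun m => by rw [Subsingleton.elim m 0, map_zero, map_zero]

/-- (continued) [cite: KnappVogan1995, Thm. 1.117 (d)] -/
theorem finiteDimensional_of_subsingleton_target [Subsingleton M'] : FiniteDimensional ℂ (M →ₗ[GKRing G] M') :=
  finiteDimensional_of_forall_eq_zero fun _ => LinearMap.ext fun _ => Subsingleton.elim _ _

/-- **Schur: `dim Hom_{(𝔤,K)}(M, M′) ≤ 1` for irreducible `M` (admissible) and `M′`** — in particular finite-dimensional
(`GKRing.exists_forall_eq_smul_of_ne_zero`). [cite: KnappVogan1995, Prop. A.12] [cite: WallachRRG1, Lemma 3.3.2] -/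
theorem finiteDimensional_of_isIrreducibleGK [StarModule ℝ A] [ContinuousStar A] [Module ℂ M] [IsScalarTower ℂ (GKRing G) M]
    (hM : IsGKModule G (GKRing.actK G M) (GKRing.actLie G M))
    (hirr : IsIrreducibleGK (GKRing.actK G M) (GKRing.actLie G M)) (hadm : IsAdmissibleGK (GKRing.actK G M))
    (hirr' : IsIrreducibleGK (GKRing.actK G M') (GKRing.actLie G M')) :
    FiniteDimensional ℂ (M →ₗ[GKRing G] M') ∧ Module.finrank ℂ (M →ₗ[GKRing G] M') ≤ 1 := by
  by_cases h0 : ∀ ψ : M →ₗ[GKRing G] M', ψ = 0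
  · haveI := finiteDimensional_of_forall_eq_zero h0
    refine ⟨inferInstance, ?_⟩
    haveI : Subsingleton (M →ₗ[GKRing G] M') := ⟨fun a b => by rw [h0 a, h0 b]⟩
    have : Module.finrank ℂ (M →ₗ[GKRing G] M') = 0 := Module.finrank_zero_of_subsingleton
    omega
  · push Not at h0
    obtain ⟨ψ, hψ⟩ := h0
    have hspan : ∀ φ : M →ₗ[GKRing G] M', ∃ c : ℂ, c • ψ = φ := fun φ => by
      obtain ⟨c, hc⟩ := GKRing.exists_forall_eq_smul_of_ne_zero hM hirr hadm hirr' φ ψ hψ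
      exact ⟨c, LinearMap.ext fun m => by rw [LinearMap.smul_apply, hc m]⟩
    haveI : FiniteDimensional ℂ (M →ₗ[GKRing G] M') := by
      refine Module.Finite.of_surjective (LinearMap.toSpanSingleton ℂ (M →ₗ[GKRing G] M') ψ) fun φ => ?_
      obtain ⟨c, hc⟩ := hspan φ
      exact ⟨c, hc⟩
    exact ⟨inferInstance, finrank_le_one ψ hspan⟩

end Literature.NumberTheory.Automorphic.GKHom

/-! ## §2 `U(1,1)`: `Hom` of finite-length modules is finite-dimensional; finite length ⟹ `Z(𝔤)` finite -/

namespace Literature.RepresentationTheory.BorelWallach2000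

open Literature.Algebra.Lie Literature.Algebra.Lie.ChevalleyEilenberg
open Literature.NumberTheory.Automorphic
open Literature.RepresentationTheory.KonnoKonno2007 Literature.RepresentationTheory.KonnoKonno2007.RealDualPair
open Literature.RepresentationTheory.KonnoKonno2007.RealDualPair.UForm
open Literature.LinearAlgebra
open U11HolDS

-- carriers `↥W`, `M ⧸ W`, `Factor` over `GKRing G11` with their `ℂ`-structures (as in `GKModuleRing` §7–§8)
set_option maxSynthPendingDepth 4

namespace U11HC

variable {M : Type*} [AddCommGroup M] [Module ℂ M] [Module (GKRing G11) M] [IsScalarTower ℂ (GKRing G11) M]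
variable (hM : IsGKModule G11 (GKRing.actK G11 M) (GKRing.actLie G11 M))
variable {M' : Type*} [AddCommGroup M'] [Module ℂ M'] [Module (GKRing G11) M'] [IsScalarTower ℂ (GKRing G11) M']
variable (hM' : IsGKModule G11 (GKRing.actK G11 M') (GKRing.actLie G11 M'))

include hM in
/-- **`Hom_{(𝔤,K)}(M, S)` is finite-dimensional for `M` of finite length and `S` irreducible** (induction along a composition series
of `M`: the consecutive quotients are irreducible, hence admissible at `U(1,1)`, and `dim Hom(irreducible, S) ≤ 1`).
[cite: KnappVogan1995, Cor. 7.207, Prop. A.12] -/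
theorem finiteDimensional_hom_of_isIrreducibleGK_target (hfl : IsFiniteLength (GKRing G11) M)
    (hirr' : IsIrreducibleGK (GKRing.actK G11 M') (GKRing.actLie G11 M')) : FiniteDimensional ℂ (M →ₗ[GKRing G11] M') := by
  obtain ⟨s, h0, hlast⟩ := (GKRing.isFiniteLength_iff_exists_compositionSeries G11 M).1 hfl
  have key : ∀ i : Fin (s.length + 1), FiniteDimensional ℂ (↥(s i) →ₗ[GKRing G11] M') := by
    intro i
    induction i using Fin.induction with
    | zero =>
      have hbot : s 0 = ⊥ := h0
      haveI : Subsingleton ↥(s 0) := by rw [hbot]; infer_instance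
      exact GKHom.finiteDimensional_of_subsingleton_source
    | succ i ih =>
      have hstep : s i.castSucc ⋖ s i.succ := s.step i
      have hF := GKRing.isGKModule_factor G11 M (s i.castSucc, s i.succ) hM
      have hirrF := GKRing.isIrreducibleGK_factor hstep
      -- `Hom(factor, M′)`: Schur
      haveI : FiniteDimensional ℂ (GKRing.Factor (s i.castSucc, s i.succ) →ₗ[GKRing G11] M') :=
        (GKHom.finiteDimensional_of_isIrreducibleGK hF hirrF (U11Irred.isAdmissibleGK_of_isIrreducibleGK hF hirrF) hirr').1
      -- `Hom(X', M′) ≅ Hom(X, M′)` with `X' = X.comap Y.subtype ≃ X`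
      haveI : FiniteDimensional ℂ (↥((s i.castSucc).comap (s i.succ).subtype) →ₗ[GKRing G11] M') := by
        haveI := ih
        exact GKHom.finiteDimensional_of_source_equiv (Submodule.comapSubtypeEquivOfLe hstep.le).symm
      exact GKHom.finiteDimensional_of_source (M := ↥(s i.succ)) ((s i.castSucc).comap (s i.succ).subtype)
  have htop : s (Fin.last _) = ⊤ := hlast
  haveI := key (Fin.last _)
  exact GKHom.finiteDimensional_of_source_equiv ((LinearEquiv.ofEq _ _ htop).trans Submodule.topEquiv)

include hM hM' in
/-- **`Hom_{(𝔤,K)}(M, M′)` is finite-dimensional for `(𝔤, K)`-modules `M`, `M′` of finite length of `U(1,1)`** (induction along a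
composition series of `M′`, using the previous theorem on the consecutive quotients). [cite: KnappVogan1995, Cor. 7.207, Prop. A.12] -/
theorem finiteDimensional_hom (hfl : IsFiniteLength (GKRing G11) M) (hfl' : IsFiniteLength (GKRing G11) M') :
    FiniteDimensional ℂ (M →ₗ[GKRing G11] M') := by
  obtain ⟨s, h0, hlast⟩ := (GKRing.isFiniteLength_iff_exists_compositionSeries G11 M').1 hfl'
  have key : ∀ j : Fin (s.length + 1), FiniteDimensional ℂ (M →ₗ[GKRing G11] ↥(s j)) := by
    intro j
    induction j using Fin.induction with
    | zero =>
      have hbot : s 0 = ⊥ := h0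
      haveI : Subsingleton ↥(s 0) := by rw [hbot]; infer_instance
      exact GKHom.finiteDimensional_of_subsingleton_target
    | succ j ih =>
      have hstep : s j.castSucc ⋖ s j.succ := s.step j
      have hF := GKRing.isGKModule_factor G11 M' (s j.castSucc, s j.succ) hM'
      have hirrF := GKRing.isIrreducibleGK_factor hstep
      -- `Hom(M, factor)`: previous theorem
      haveI : FiniteDimensional ℂ (M →ₗ[GKRing G11] GKRing.Factor (s j.castSucc, s j.succ)) :=
        finiteDimensional_hom_of_isIrreducibleGK_target hM hfl hirrF
      -- `Hom(M, X') ≅ Hom(M, X)`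
      haveI : FiniteDimensional ℂ (M →ₗ[GKRing G11] ↥((s j.castSucc).comap (s j.succ).subtype)) := by
        haveI := ih
        exact GKHom.finiteDimensional_of_target_equiv (Submodule.comapSubtypeEquivOfLe hstep.le).symm
      exact GKHom.finiteDimensional_of_target (M' := ↥(s j.succ)) ((s j.castSucc).comap (s j.succ).subtype)
  have htop : s (Fin.last _) = ⊤ := hlast
  haveI := key (Fin.last _)
  exact GKHom.finiteDimensional_of_target_equiv ((LinearEquiv.ofEq _ _ htop).trans Submodule.topEquiv)

include hM in
/-- In particular **`End_{(𝔤,K)}(M)` is finite-dimensional** for `M` of finite length. [cite: KnappVogan1995, Cor. 7.207, Prop. A.12] -/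
theorem finiteDimensional_end (hfl : IsFiniteLength (GKRing G11) M) : FiniteDimensional ℂ (M →ₗ[GKRing G11] M) :=
  finiteDimensional_hom hM hM hfl hfl

include hM in
/-- **Every `z ∈ Z(𝔤)` acts on a `(𝔤, K)`-module of `U(1,1)` by a `(𝔤, K)`-map** (it commutes with `𝔤`, hence with the connected
`K`: `U11Weights.actK_comp_centerAction`; then `GKRing.mkLinearMap`). [cite: KnappVogan1995, Thm. 1.117 (d), §IV.8 (remark after Prop. 4.117)] -/
theorem exists_restrictScalars_eq_centerAction (z : centerU G11) :
    ∃ φ : M →ₗ[GKRing G11] M, φ.restrictScalars ℂ = centerAction (GKRing.actLie G11 M) z :=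
  ⟨GKRing.mkLinearMap G11 (centerAction (GKRing.actLie G11 M) z)
      (fun k m => by
        have h := LinearMap.congr_fun (U11Weights.actK_comp_centerAction hM k z) m
        rw [LinearMap.comp_apply, LinearMap.comp_apply] at h
        exact h.symm)
      (fun X m => by
        have h := LinearMap.congr_fun (commute_centerAction_lie (GKRing.actLie G11 M) z X).eq m
        rw [Module.End.mul_apply, Module.End.mul_apply] at h
        exact h),
    LinearMap.ext fun m => rfl⟩

include hM in
/-- **Every `(𝔤, K)`-module of finite length of `U(1,1)` is `Z(𝔤)` finite** (Knapp–Vogan's notion (7.13) for `Z(𝔤) = centerU`,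
`IsCenterFinite`): the image of `Z(𝔤)` lies in the finite-dimensional algebra `End_{(𝔤,K)}(M)` — «`ℱ(𝔤, K)` … is a full
subcategory of `𝒞_{Zf}(𝔤, K)`». [cite: KnappVogan1995, Cor. 7.207 (c) ⟹ (b), §VII.13 (before Cor. 7.208)] -/
theorem isCenterFinite_of_isFiniteLength (hfl : IsFiniteLength (GKRing G11) M) : IsCenterFinite (GKRing.actLie G11 M) := by
  haveI := finiteDimensional_end hM hfl
  -- the subalgebra of `GKRing G11`-linear endomorphisms of `M`, inside `End_ℂ M`
  let T : Subalgebra ℂ (Module.End ℂ M) :=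
    { carrier := {f | ∀ (r : GKRing G11) (m : M), f (r • m) = r • f m}
      mul_mem' := fun {f g} hf hg r m => by rw [Module.End.mul_apply, Module.End.mul_apply, hg, hf]
      one_mem' := fun r m => rfl
      add_mem' := fun {f g} hf hg r m => by rw [LinearMap.add_apply, LinearMap.add_apply, hf, hg, smul_add]
      zero_mem' := fun r m => by rw [LinearMap.zero_apply, LinearMap.zero_apply, smul_zero]
      algebraMap_mem' := fun c r m => by
        rw [Module.algebraMap_end_apply, Module.algebraMap_end_apply]
        exact (smul_comm r c m).symm }
  -- it is the image of `End_{GKRing}(M)`, hence finite-dimensional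
  let ι : T →ₗ[ℂ] (M →ₗ[GKRing G11] M) :=
    { toFun := fun f => { toFun := (f : Module.End ℂ M), map_add' := map_add _, map_smul' := fun r m => f.2 r m }
      map_add' := fun f g => LinearMap.ext fun m => rfl
      map_smul' := fun c f => LinearMap.ext fun m => rfl }
  have hι : Function.Injective ι := fun f g h => Subtype.ext (LinearMap.ext fun m => LinearMap.congr_fun h m)
  haveI : FiniteDimensional ℂ T := Module.Finite.of_injective ι hι
  have hle : Algebra.adjoin ℂ (Set.range (centerAction (GKRing.actLie G11 M))) ≤ T := by
    refine Algebra.adjoin_le ?_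
    rintro _ ⟨z, rfl⟩
    obtain ⟨φ, hφ⟩ := exists_restrictScalars_eq_centerAction hM z
    intro r m
    rw [← hφ, LinearMap.restrictScalars_apply, map_smul]
    rfl
  haveI : FiniteDimensional ℂ (Subalgebra.toSubmodule T) := FiniteDimensional.subalgebra_toSubmodule inferInstance
  have hle' : Subalgebra.toSubmodule (Algebra.adjoin ℂ (Set.range (centerAction (GKRing.actLie G11 M)))) ≤
      Subalgebra.toSubmodule T := Subalgebra.toSubmodule.le_iff_le.mpr hle
  exact ⟨FiniteDimensional.of_subalgebra_toSubmodule (Submodule.finiteDimensional_of_le hle')⟩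


include hM in
/-- Hence **Knapp–Vogan's Prop. 7.20 applies to every `(𝔤, K)`-module of finite length of `U(1,1)`: `M = ⨁_θ P_θ(M)` over the
characters `θ : Z(𝔤) → ℂ`, finitely many non-zero** (`GKModulesPrimary`). [cite: KnappVogan1995, §VII.2 Prop. 7.20, Cor. 7.207] -/
theorem isInternal_primaryComponent_of_isFiniteLength [DecidableEq (centerU G11 →ₐ[ℝ] ℂ)] (hfl : IsFiniteLength (GKRing G11) M) :
    DirectSum.IsInternal (fun θ : centerU G11 →ₐ[ℝ] ℂ => primaryComponent (GKRing.actLie G11 M) θ) ∧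
      {θ : centerU G11 →ₐ[ℝ] ℂ | primaryComponent (GKRing.actLie G11 M) θ ≠ ⊥}.Finite :=
  ⟨isInternal_primaryComponent _ (isCenterFinite_of_isFiniteLength hM hfl),
    finite_setOf_primaryComponent_ne_bot _ (isCenterFinite_of_isFiniteLength hM hfl)⟩

end U11HC

end Literature.RepresentationTheory.BorelWallach2000
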